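import Summits.CriticalPhenomena.SAWScalingLimit.Theorems.SAWDevelopingMapPotentialExistsExtension
import HarnessLib

/-!
# Route `SAWDevelopingMap`, item `PotentialExists` (stmt-CriticalPhenomena-8299) — the discrete Poincaré lemma

Helper file 3/4 for the potential lemma `F = dH` of the route `SAWDevelopingMap`
(`Summits/CriticalPhenomena/SAWScalingLimit/Theses/SAWDevelopingMap.lean`, decl `PotentialExists`).

**`exists_potential`** (discrete Poincaré lemma on the triangulation dual to a hexagonal
domain).  Data: a finite set `Λ` of faces of the triangular lattice `𝕋` (= vertices of `ℍ`) with
connected complement (`hexDomainSimplyConnected Λ`) and a "discrete 1-form" `g f f' ∈ ℂ` on the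
darts `f → f'` of `ℍ` (read: the increment prescribed along the dual `𝕋`-edge, traversed with
`f` on its left), antisymmetric on `Λ` and closed on every face of `Λ` (the three darts out of a
face sum to zero).  Conclusion: a potential `H : Site 2 → ℂ` on the vertices of `𝕋` whose
increment along each edge of each face of `Λ`, traversed counter-clockwise around that face,
is the prescribed one.  In coordinates (`e₀ = Pi.single 0 1`, `e₁ = Pi.single 1 1`): the up
face `(x, 0)` has counter-clockwise vertices `x, x + e₀, x + e₁` and the faces across these
three edges are `(x - e₁, 1)`, `(x, 1)`, `(x - e₀, 1)`; the down face `(x, 1)` has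
counter-clockwise vertices `x + e₀, x + e₀ + e₁, x + e₁` and the faces across are `(x + e₀, 0)`,
`(x + e₁, 0)`, `(x, 0)`.

Proof: induction on `|Λ|`, removing the topmost face `v` (it has a neighbour `u ∉ Λ` above it,
so `Λ ∖ {v}` still has connected complement, `simplyConnected_erase`), through the one-face
extension steps `step_up` (sibling file `SAWDevelopingMapPotentialExistsExtension.lean`) and
`step_down` (here, the mirror image of `step_up` for a topmost down face `(x, 1)`,
`(x + e₁, 0) ∉ Λ`).

No new definitions; every declaration is proved.
-/

noncomputable section

namespace Summit.CriticalPhenomena.SAWScalingLimit.Theorems.PotentialExists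

open Finset Literature.Probability.LatticeModels Literature.Probability.RandomPlanarGeometry.SAW

/-! ### The induction step at a topmost down face -/

/-- **Induction step, down face.** If `(x, 1) ∈ Λ`, the face `(x + e₁, 0)` above it is not in
`Λ`, the complement of `Λ` is connected, `g` is antisymmetric and closed on `Λ`, and `H'` is a
potential for `g` on `Λ ∖ {(x, 1)}`, then there is a potential for `g` on `Λ`. [folklore] -/
theorem step_down {Λ : Finset HexVertex} (hΛ : hexDomainSimplyConnected Λ)
    {g : HexVertex → HexVertex → ℂ}
    (hanti : ∀ v ∈ Λ, ∀ w ∈ Λ, hexGraph.Adj v w → g w v = -g v w)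
    (hcl1 : ∀ x : Site 2, (x, (1 : Fin 2)) ∈ Λ →
      g (x, 1) (x + Pi.single 0 1, 0) + g (x, 1) (x + Pi.single 1 1, 0) + g (x, 1) (x, 0) = 0)
    {x : Site 2} (hv : (x, (1 : Fin 2)) ∈ Λ) (hu : (x + Pi.single 1 1, (0 : Fin 2)) ∉ Λ)
    {H' : Site 2 → ℂ}
    (hH' : (∀ y : Site 2, (y, (0 : Fin 2)) ∈ Λ.erase (x, 1) →
        H' (y + Pi.single 0 1) - H' y = g (y, 0) (y - Pi.single 1 1, 1) ∧
        H' (y + Pi.single 1 1) - H' (y + Pi.single 0 1) = g (y, 0) (y, 1) ∧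
        H' y - H' (y + Pi.single 1 1) = g (y, 0) (y - Pi.single 0 1, 1)) ∧
      (∀ y : Site 2, (y, (1 : Fin 2)) ∈ Λ.erase (x, 1) →
        H' (y + Pi.single 0 1 + Pi.single 1 1) - H' (y + Pi.single 0 1) =
            g (y, 1) (y + Pi.single 0 1, 0) ∧
        H' (y + Pi.single 1 1) - H' (y + Pi.single 0 1 + Pi.single 1 1) =
            g (y, 1) (y + Pi.single 1 1, 0) ∧
        H' (y + Pi.single 0 1) - H' (y + Pi.single 1 1) = g (y, 1) (y, 0))) :
    ∃ H : Site 2 → ℂ, (∀ y : Site 2, (y, (0 : Fin 2)) ∈ Λ →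
        H (y + Pi.single 0 1) - H y = g (y, 0) (y - Pi.single 1 1, 1) ∧
        H (y + Pi.single 1 1) - H (y + Pi.single 0 1) = g (y, 0) (y, 1) ∧
        H y - H (y + Pi.single 1 1) = g (y, 0) (y - Pi.single 0 1, 1)) ∧
      (∀ y : Site 2, (y, (1 : Fin 2)) ∈ Λ →
        H (y + Pi.single 0 1 + Pi.single 1 1) - H (y + Pi.single 0 1) =
            g (y, 1) (y + Pi.single 0 1, 0) ∧
        H (y + Pi.single 1 1) - H (y + Pi.single 0 1 + Pi.single 1 1) =
            g (y, 1) (y + Pi.single 1 1, 0) ∧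
        H (y + Pi.single 0 1) - H (y + Pi.single 1 1) = g (y, 1) (y, 0)) := by
  classical
  set e0 : Site 2 := Pi.single 0 1 with he0
  set e1 : Site 2 := Pi.single 1 1 with he1
  set R : Site 2 → Site 2 → Prop :=
    fun p q => ∃ f ∈ Λ.erase (x, 1), p ∈ hexFaceVertices f ∧ q ∈ hexFaceVertices f with hR
  have hRs : ∀ p q, R p q → R q p := fun p q ⟨f, hf, hp, hq⟩ => ⟨f, hf, hq, hp⟩
  -- adjacency and shared vertices of `(x, 1)` with its three neighbours
  have hadj0 : hexGraph.Adj (x, 1) (x + e0, 0) :=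
    (hexGraph_adj_iff_of_snd_eq_one x _).2 (Or.inr (Or.inl rfl))
  have hadj1 : hexGraph.Adj (x, 1) (x + e1, 0) :=
    (hexGraph_adj_iff_of_snd_eq_one x _).2 (Or.inr (Or.inr rfl))
  have hadj2 : hexGraph.Adj (x, 1) (x, 0) := (hexGraph_adj_iff_of_snd_eq_one x _).2 (Or.inl rfl)
  have hne01 : ((x + e0, 0) : HexVertex) ≠ (x + e1, 0) := by
    intro h; have := congrArg (fun f : HexVertex => f.1 0) h; simp [he0, he1] at this
  have hne21 : ((x, 0) : HexVertex) ≠ (x + e1, 0) := by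
    intro h; have := congrArg (fun f : HexVertex => f.1 1) h; simp [he1] at this
  have mv : x + e0 ∈ hexFaceVertices (x, (1 : Fin 2)) ∧
      x + e0 + e1 ∈ hexFaceVertices (x, (1 : Fin 2)) ∧
      x + e1 ∈ hexFaceVertices (x, (1 : Fin 2)) := by
    simp only [mem_hexFaceVertices_one, he0, he1, add_assoc]; simp
  have m0 : x + e0 ∈ hexFaceVertices (x + e0, (0 : Fin 2)) ∧
      x + e0 + e1 ∈ hexFaceVertices (x + e0, (0 : Fin 2)) := by
    simp only [mem_hexFaceVertices_zero, he0, he1]; simp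
  have m1 : x + e0 + e1 ∈ hexFaceVertices (x + e1, (0 : Fin 2)) ∧
      x + e1 ∈ hexFaceVertices (x + e1, (0 : Fin 2)) := by
    simp only [mem_hexFaceVertices_zero, site_two_eq_iff, Pi.add_apply, he0, he1,
      Pi.single_apply]; simp
  have m2 : x + e1 ∈ hexFaceVertices (x, (0 : Fin 2)) ∧
      x + e0 ∈ hexFaceVertices (x, (0 : Fin 2)) := by
    simp only [mem_hexFaceVertices_zero, he0, he1]; simp
  have hq01 : x + e0 ≠ x + e0 + e1 := by
    intro h; have := congrFun h 1; simp [he0, he1] at this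
  have hq12 : x + e0 + e1 ≠ x + e1 := by
    intro h; have := congrFun h 0; simp [he0, he1] at this
  have hq20 : x + e1 ≠ x + e0 := by
    intro h; have := congrFun h 0; simp [he0, he1] at this
  -- the increments already present in `H'` across edges shared with faces of `Λ`
  have hd0 : ((x + e0, 0) : HexVertex) ∈ Λ →
      H' (x + e0 + e1) - H' (x + e0) = g (x, 1) (x + e0, 0) := by
    intro hw
    have hw' : (x + e0, (0 : Fin 2)) ∈ Λ.erase (x, 1) :=
      Finset.mem_erase.2 ⟨fun h => absurd (congrArg Prod.snd h) (by simp), hw⟩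
    have e := (hH'.1 (x + e0) hw').2.2
    have ha := hanti _ hv _ hw hadj0
    rw [show x + e0 - e0 = x from add_sub_cancel_right x e0] at e
    linear_combination -e - ha
  have hd2 : ((x, 0) : HexVertex) ∈ Λ → H' (x + e0) - H' (x + e1) = g (x, 1) (x, 0) := by
    intro hw
    have hw' : (x, (0 : Fin 2)) ∈ Λ.erase (x, 1) :=
      Finset.mem_erase.2 ⟨fun h => absurd (congrArg Prod.snd h) (by simp), hw⟩
    have e := (hH'.1 x hw').2.1
    have ha := hanti _ hv _ hw hadj2
    linear_combination -e - ha
  -- the three compatibilities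
  have c01 : Relation.ReflTransGen R (x + e0) (x + e0 + e1) →
      H' (x + e0 + e1) - H' (x + e0) = g (x, 1) (x + e0, 0) := by
    intro hr
    by_cases hw : ((x + e0, 0) : HexVertex) ∈ Λ
    · exact hd0 hw
    · exact absurd hr (not_reflTransGen_of_two_outer_nbrs hΛ hv hw hu hne01 hadj0 hadj1 mv.1 m0.1
        mv.2.1 m0.2 hq01)
  have c12 : Relation.ReflTransGen R (x + e0 + e1) (x + e1) →
      H' (x + e1) - H' (x + e0 + e1) = g (x, 1) (x + e1, 0) := by
    intro hr
    by_cases hw : ((x + e0, 0) : HexVertex) ∈ Λ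
    · by_cases hw' : ((x, 0) : HexVertex) ∈ Λ
      · have := hcl1 x hv
        linear_combination -(hd0 hw) - (hd2 hw') - this
      · exact absurd hr (not_reflTransGen_of_two_outer_nbrs hΛ hv hu hw' hne21.symm hadj1 hadj2
          mv.2.1 m1.1 mv.2.2 m1.2 hq12)
    · exact absurd hr (not_reflTransGen_of_two_outer_nbrs hΛ hv hu hw hne01.symm hadj1 hadj0
        mv.2.1 m1.1 mv.2.2 m1.2 hq12)
  have c20 : Relation.ReflTransGen R (x + e1) (x + e0) →
      H' (x + e0) - H' (x + e1) = g (x, 1) (x, 0) := by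
    intro hr
    by_cases hw : ((x, 0) : HexVertex) ∈ Λ
    · exact hd2 hw
    · exact absurd hr (not_reflTransGen_of_two_outer_nbrs hΛ hv hw hu hne21 hadj2 hadj1 mv.2.2
        m2.1 mv.1 m2.2 hq20)
  obtain ⟨H, hHR, hH01, hH12, hH20⟩ :=
    extend_three R hRs H' (x + e0) (x + e0 + e1) (x + e1) _ _ _ (hcl1 x hv) c01 c12 c20
  -- `H` is a potential on `Λ`
  have hold : ∀ f ∈ Λ.erase (x, 1), ∀ p q : Site 2, p ∈ hexFaceVertices f →
      q ∈ hexFaceVertices f → H q - H p = H' q - H' p :=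
    fun f hf p q hp hq => hHR p q ⟨f, hf, hp, hq⟩
  refine ⟨H, fun y hy => ?_, fun y hy => ?_⟩
  · have hy' : (y, (0 : Fin 2)) ∈ Λ.erase (x, 1) :=
      Finset.mem_erase.2 ⟨fun h => absurd (congrArg Prod.snd h) (by simp), hy⟩
    have my : y ∈ hexFaceVertices (y, (0 : Fin 2)) ∧
        y + e0 ∈ hexFaceVertices (y, (0 : Fin 2)) ∧
        y + e1 ∈ hexFaceVertices (y, (0 : Fin 2)) := by
      simp only [mem_hexFaceVertices_zero, he0, he1]; simp
    obtain ⟨a, b, c⟩ := hH'.1 y hy'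
    exact ⟨by rw [hold _ hy' _ _ my.1 my.2.1, a], by rw [hold _ hy' _ _ my.2.1 my.2.2, b],
      by rw [hold _ hy' _ _ my.2.2 my.1, c]⟩
  · by_cases hyx : y = x
    · subst hyx; exact ⟨hH01, hH12, hH20⟩
    · have hy' : (y, (1 : Fin 2)) ∈ Λ.erase (x, 1) :=
        Finset.mem_erase.2 ⟨fun h => hyx (congrArg Prod.fst h), hy⟩
      have my : y + e0 ∈ hexFaceVertices (y, (1 : Fin 2)) ∧
          y + e0 + e1 ∈ hexFaceVertices (y, (1 : Fin 2)) ∧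
          y + e1 ∈ hexFaceVertices (y, (1 : Fin 2)) := by
        simp only [mem_hexFaceVertices_one, he0, he1, add_assoc]; simp
      obtain ⟨a, b, c⟩ := hH'.2 y hy'
      exact ⟨by rw [hold _ hy' _ _ my.1 my.2.1, a], by rw [hold _ hy' _ _ my.2.1 my.2.2, b],
        by rw [hold _ hy' _ _ my.2.2 my.1, c]⟩

/-! ### The discrete Poincaré lemma -/

/-- **Discrete Poincaré lemma on a simply connected hexagonal domain.** If the complement of the
finite face set `Λ` is connected in `ℍ` and `g` is a discrete 1-form on the darts of `ℍ` out of
faces of `Λ` (antisymmetric on `Λ`, the three darts out of every face of `Λ` summing to zero),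
then there is `H : Site 2 → ℂ` on the vertices of `𝕋` with `H t - H s = g f f'` for every face
`f ∈ Λ`, every neighbour `f'`, and the common edge `s → t` of `f`, `f'` traversed with `f` on its
left — written out in coordinates for up faces `(x, 0)` (vertices `x, x + e₀, x + e₁`, faces
across `(x - e₁, 1)`, `(x, 1)`, `(x - e₀, 1)`) and down faces `(x, 1)` (vertices
`x + e₀, x + e₀ + e₁, x + e₁`, faces across `(x + e₀, 0)`, `(x + e₁, 0)`, `(x, 0)`).
Proof: induction on `|Λ|` through `step_up` / `step_down` at the topmost face. [folklore] -/
theorem exists_potential {Λ : Finset HexVertex} (hΛ : hexDomainSimplyConnected Λ)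
    {g : HexVertex → HexVertex → ℂ}
    (hanti : ∀ v ∈ Λ, ∀ w ∈ Λ, hexGraph.Adj v w → g w v = -g v w)
    (hcl0 : ∀ x : Site 2, (x, (0 : Fin 2)) ∈ Λ →
      g (x, 0) (x - Pi.single 1 1, 1) + g (x, 0) (x, 1) + g (x, 0) (x - Pi.single 0 1, 1) = 0)
    (hcl1 : ∀ x : Site 2, (x, (1 : Fin 2)) ∈ Λ →
      g (x, 1) (x + Pi.single 0 1, 0) + g (x, 1) (x + Pi.single 1 1, 0) + g (x, 1) (x, 0) = 0) :
    ∃ H : Site 2 → ℂ, (∀ y : Site 2, (y, (0 : Fin 2)) ∈ Λ →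
        H (y + Pi.single 0 1) - H y = g (y, 0) (y - Pi.single 1 1, 1) ∧
        H (y + Pi.single 1 1) - H (y + Pi.single 0 1) = g (y, 0) (y, 1) ∧
        H y - H (y + Pi.single 1 1) = g (y, 0) (y - Pi.single 0 1, 1)) ∧
      (∀ y : Site 2, (y, (1 : Fin 2)) ∈ Λ →
        H (y + Pi.single 0 1 + Pi.single 1 1) - H (y + Pi.single 0 1) =
            g (y, 1) (y + Pi.single 0 1, 0) ∧
        H (y + Pi.single 1 1) - H (y + Pi.single 0 1 + Pi.single 1 1) =
            g (y, 1) (y + Pi.single 1 1, 0) ∧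
        H (y + Pi.single 0 1) - H (y + Pi.single 1 1) = g (y, 1) (y, 0)) := by
  classical
  suffices key : ∀ (n : ℕ) (Λ : Finset HexVertex), Λ.card = n → hexDomainSimplyConnected Λ →
      (∀ v ∈ Λ, ∀ w ∈ Λ, hexGraph.Adj v w → g w v = -g v w) →
      (∀ x : Site 2, (x, (0 : Fin 2)) ∈ Λ →
        g (x, 0) (x - Pi.single 1 1, 1) + g (x, 0) (x, 1) + g (x, 0) (x - Pi.single 0 1, 1) = 0) →
      (∀ x : Site 2, (x, (1 : Fin 2)) ∈ Λ →
        g (x, 1) (x + Pi.single 0 1, 0) + g (x, 1) (x + Pi.single 1 1, 0) + g (x, 1) (x, 0) = 0) →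
      ∃ H : Site 2 → ℂ, (∀ y : Site 2, (y, (0 : Fin 2)) ∈ Λ →
          H (y + Pi.single 0 1) - H y = g (y, 0) (y - Pi.single 1 1, 1) ∧
          H (y + Pi.single 1 1) - H (y + Pi.single 0 1) = g (y, 0) (y, 1) ∧
          H y - H (y + Pi.single 1 1) = g (y, 0) (y - Pi.single 0 1, 1)) ∧
        (∀ y : Site 2, (y, (1 : Fin 2)) ∈ Λ →
          H (y + Pi.single 0 1 + Pi.single 1 1) - H (y + Pi.single 0 1) =
              g (y, 1) (y + Pi.single 0 1, 0) ∧
          H (y + Pi.single 1 1) - H (y + Pi.single 0 1 + Pi.single 1 1) =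
              g (y, 1) (y + Pi.single 1 1, 0) ∧
          H (y + Pi.single 0 1) - H (y + Pi.single 1 1) = g (y, 1) (y, 0)) from
    key _ Λ rfl hΛ hanti hcl0 hcl1
  intro n
  induction n with
  | zero =>
    intro Λ hcard _ _ _ _
    rw [Finset.card_eq_zero] at hcard
    subst hcard
    exact ⟨fun _ => 0, fun y hy => by simp at hy, fun y hy => by simp at hy⟩
  | succ m ih =>
    intro Λ hcard hΛ hanti hcl0 hcl1
    have hne : Λ.Nonempty := Finset.card_pos.1 (by omega)
    -- the topmost face of `Λ`
    obtain ⟨v, hv, hmax⟩ :=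
      Finset.exists_max_image Λ (fun f : HexVertex => 2 * f.1 1 + ((f.2 : ℕ) : ℤ)) hne
    obtain ⟨x, k⟩ := v
    have hcard' : ∀ f ∈ Λ, (Λ.erase f).card = m := fun f hf => by
      rw [Finset.card_erase_of_mem hf, hcard]; rfl
    have hanti' : ∀ f : HexVertex, ∀ v ∈ Λ.erase f, ∀ w ∈ Λ.erase f,
        hexGraph.Adj v w → g w v = -g v w :=
      fun f v hv w hw h => hanti v (Finset.mem_of_mem_erase hv) w (Finset.mem_of_mem_erase hw) h
    have hcl0' : ∀ f : HexVertex, ∀ x : Site 2, (x, (0 : Fin 2)) ∈ Λ.erase f →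
        g (x, 0) (x - Pi.single 1 1, 1) + g (x, 0) (x, 1) + g (x, 0) (x - Pi.single 0 1, 1) = 0 :=
      fun f x hx => hcl0 x (Finset.mem_of_mem_erase hx)
    have hcl1' : ∀ f : HexVertex, ∀ x : Site 2, (x, (1 : Fin 2)) ∈ Λ.erase f →
        g (x, 1) (x + Pi.single 0 1, 0) + g (x, 1) (x + Pi.single 1 1, 0) + g (x, 1) (x, 0) = 0 :=
      fun f x hx => hcl1 x (Finset.mem_of_mem_erase hx)
    fin_cases k
    · -- up face: the face `(x, 1)` above it is not in `Λ`
      simp only [Fin.zero_eta] at hv hmax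
      have hu : ((x, 1) : HexVertex) ∉ Λ := fun h => by
        have := hmax _ h
        simp at this
      have hadj : hexGraph.Adj (x, 0) (x, 1) :=
        (hexGraph_adj_iff_of_snd_eq_zero_holds x _).2 (Or.inl rfl)
      obtain ⟨H', hH'⟩ := ih (Λ.erase (x, 0)) (hcard' _ hv) (simplyConnected_erase hΛ hu hadj)
        (hanti' _) (hcl0' _) (hcl1' _)
      exact step_up hΛ hanti hcl0 hv hu hH'
    · -- down face: the face `(x + e₁, 0)` above it is not in `Λ`
      simp only [Fin.mk_one] at hv hmax
      have hu : ((x + Pi.single 1 1, 0) : HexVertex) ∉ Λ := fun h => by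
        have := hmax _ h
        simp at this
        omega
      have hadj : hexGraph.Adj (x, 1) (x + Pi.single 1 1, 0) :=
        (hexGraph_adj_iff_of_snd_eq_one x _).2 (Or.inr (Or.inr rfl))
      obtain ⟨H', hH'⟩ := ih (Λ.erase (x, 1)) (hcard' _ hv) (simplyConnected_erase hΛ hu hadj)
        (hanti' _) (hcl0' _) (hcl1' _)
      exact step_down hΛ hanti hcl1 hv hu hH'

end Summit.CriticalPhenomena.SAWScalingLimit.Theorems.PotentialExists

end
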